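import Summits.QuantumAdvantage.QuantumAdvantage.Theses.CubicForrelation
import Literature.Computability.QuantumComplexity.SignedCubicForrelation
import Literature.Computability.QuantumComplexity.ForrelationDerivativeTables
import Literature.Computability.QuantumComplexity.ForrelationSignTransport
import Literature.Computability.QuantumComplexity.ForrelationMSubspaceDuality
import Literature.Computability.QuantumComplexity.ForrelationDirectSum
import Summits.QuantumAdvantage.QuantumAdvantage.Theorems.CubicForrelationInPrBPP.Negative.SignedSlice
import Summits.QuantumAdvantage.QuantumAdvantage.Theorems.CubicForrelationInPrBPP.Negative.FlatSign
import Summits.QuantumAdvantage.QuantumAdvantage.Theorems.SignedCubicForrelationInPrBPP.Negative.CrossCorrelation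
import Summits.QuantumAdvantage.QuantumAdvantage.Theorems.SignedCubicForrelationInPrBPP.Negative.GoldCube

/-!
# Line `transpose-defect-locator` — skeleton for crux `CubicForrelation.SignedCubicForrelationInPrBPP`
(stmt-QuantumAdvantage-13933, route `QuantumAdvantage/CubicForrelation`, r7 = ¬X), crux-plan seat, 2026-08-16.

Crux `S` (BY NAME below): signed cubic 2-fold Forrelation (`k = 2`, `n` even, both circuits of 𝔽₂-degree ≤ 3;
YES `Φ ≥ 3/5`, NO `Φ ≤ -3/5`) is in textbook `PromiseBPP'`; by `rfl` it is
`signedCubicForrelationProblem 2 ∈ PromiseBPP'` (`crux_eq`).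

## The lever, made exact (two PROVED identities of this file)

Write `T_a(h,u) = dwt (signOf ∘ a) h u` for the derivative Walsh table (every entry an exact quadratic Gauss sum
when `a` is cubic — the landed Φ²-engine) and introduce the **forrelation density**
`Ψ_{a,b}(x) := (-1)^{a(x)} · 2^{-n/2} · W_{(-1)^b}(x)` (`density`), so that `E_x Ψ = Φ(a,b)`
(`forrelation_eq_mean_density`) and `E_x Ψ² = 1`.

* `rowScore_eq` : `Σ_u T_a(h,u) · T_b(u,h) = 2ⁿ · Σ_x Ψ(x) Ψ(x ⊕ h)` — the transposed-table statistics of the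
  idea card (row `h` of `T_a` against column `h` of `T_b`) are EXACTLY the autocorrelation function of `Ψ`;
  equivalently (Wiener–Khinchin) everything the tables know is the POWER SPECTRUM
  `power a b w := (2^{-n} Σ_x Ψ(x)(-1)^{w·x})² = Φ(a ⊕ ℓ_w, b)²`, each value of which is one run of the landed
  Φ²-estimator on the twisted (still cubic) instance; `power a b 0 = Φ²` (`power_zeroVec`). The SIGN of `Φ` is the
  phase of `Ψ̂(0)` — the tables are sign-blind (Disproof §3a, `dwt_signOf_not`) precisely because a power spectrum is.
* `sum_power_eq_one`, `card_heavy_mul_le` : `Σ_w power a b w = 1` (Parseval), hence at most `1/τ` directions are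
  `τ`-heavy — the dimension budget of every cut below.
* `power_oneSided` : if `Φ(a₀,b₀)² = 1` (exact core) and `a = a₀ ⊕ δ` (ANY `δ`, one-sided damage) then
  `Ψ_{a,b₀} = Φ(a₀,b₀)·(-1)^δ` pointwise (`density_oneSided`) and `power a b₀ w = (2^{-n} W_{(-1)^δ}(w))²`:
  the power spectrum of the damaged pair IS the Walsh power spectrum of the damage. Hence its heavy directions
  are the Walsh support of `δ`, which spans `dir(δ)^⊥` (`dir` = period space): the ONE-SIDED LOCATION THEOREM of
  the card / triage r1-2 ("dir(δ) = {h : row agreement = 1}") in spectral form, with no accidental-agreement caveat.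

## The line (flag framework; triage r1-2: "damage need not be REMOVED, only its forms found — flag shrink")

A bi-isotropic FLAG of `(a,b)` of defect `t` is a pair of subspaces `E`, `W ⊆ E^⊥` with `a` of degree ≤ 2 on the
cosets of `E`, `b` of degree ≤ 2 on the cosets of `W`, and `|E|·|W| ≥ 2^{n-t}` (`HasFlag t a b`). Given a flag the
Lagrangian-splitting estimator (crux idea `lagrangian-splitting`: `E X = Φ` EXACTLY, `E X² ≤ 1`, cost `2^t` Gauss
sums per sample) reads `Φ` WITH ITS SIGN. The locator's job is to supply the flag on DAMAGED cores: cut a flag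
`(E, W)` of the exact core by the heavy directions of the two power spectra,
`E' = E ∩ Heavy_τ(power a b)^⊥`, `W' = W ∩ Heavy_τ(power b a)^⊥` (`cut`); by Parseval `#Heavy_τ ≤ 1/τ`, so the cut
costs ≤ `2/τ` dimensions, and the heavy directions are Kushilevitz–Mansour/Goldreich–Levin-findable from estimated
row scores (the Fourier coefficients of `h ↦ 4^{-n} Σ_u T_a(h,u)T_b(u,h)` are exactly the values `power a b w ≥ 0`).

NEGATIVE FINDING FIRST (answers triage r1-1/r1-3 "two-sided confinement / max κ is the first lemma"): confinement
of in-promise two-sided damage to bounded Kasami–Tokura type / bounded juntas is FALSE. Iterated shears: on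
`m = 2k+3` bits let `T_k(y) = (y₁, y₂, …, q_i ↦ q_i ⊕ y₁y₂ (i = 1…k), …, y_m ⊕ Σ_i p_i q_i)` (triangular, quadratic,
a permutation), `b = y′·T_k(y″)` (cubic MM bent), `a =` the degree-≤3 truncation of its dual `x″·T_k⁻¹(x′)` (whose
quartic part is `x″_m x′₁x′₂·Σ_i x′_{p_i}`, the indicator of a codim-4 flat, weight `2ⁿ/16`). Then `Φ(a,b) = 7/8` for
EVERY `k`, `a` is itself MM bent (`x″·R(x′)`, `R⁻¹` cubic), the nearest exact CUBIC core is the S-core (all shears but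
the last), at distance `1/4 - 2^{-k-2} < 1/4` on both sides (radius-near), and both differences `x″_m·Σ x′_{p_i}x′_{q_i}`,
`y′_m·Σ y″_{p_i}y″_{q_i}` are `(2k+1)`-juntas of UNBOUNDED size — yet `(x″-directions, y′-directions)` is a DEFECT-0
flag of `(a,b)` (kit j013319 PART B checks k = 1…4). So the right invariant is flag defect, not damage type, and the
junta-confinement stub the triage asked for is dropped rather than filed false; `K = 1` of this family is the route's
T-family.

Registered stubs (4) and the kernel-checked composition:
* `stub_coreFlag` (L, ≈ r5 `ExactPairsMaioranaMcFarland` + Carlet Prop. 54, weakened to bounded defect): every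
  exact cubic pair has a flag of defect ≤ `t₂` (MM#: `t₂ = 0`, the M-subspace and its orthogonal,
  `dual_affine_on_perp_cosets`). Shared with the r5 lines / `lagrangian-splitting` (E) on the exact slice.
* `stub_flagCut` (L, OPEN — THIS CARD's load-bearing statement, hardest proper stub): for an in-promise pair within
  the decoding radius of an exact cubic core, the heavy-direction cut of any defect-≤-`t₂` flag of that core is a flag
  of `(a,b)`, losing ≤ `c` dimensions per side (`τ, c` depend on `t₂` only). One-sided case: TRUE by `power_oneSided`
  (+ the one-sided in-promise bound `K ≤ 5`, Kasami–Tokura, giving `τ = 4^{-5}`). Two-sided: the bet (failure mode: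
  destructive interference hides a needed cut direction; a lopsided core flag on which `T_{a₁}` vanishes only by
  cancellation). Hand checks: T-family passes (`τ = 1/64`, `c = 2`), iterated shears pass (no cut needed). Kit
  j013398 (PART A, MM cores inner-product / Gold⊕id / Gold⊕Gold at `n = 8, 10, 12`, random one- and two-sided
  Kasami–Tokura damage incl. 150 hidden re-coring scenarios = exact shear deformation + damage, i.e. the instance
  presented relative to a NON-nearest core): 768 in-promise instances (168 two-sided), the uncut core flag is invalid
  in 537 of them, and the heavy-direction cut at `τ = 1/64` yields a valid bi-isotropic flag in 768/768
  (`τ = 1/16`: 767/768, `τ = 1/256`: 768/768); mean defect after the cut 5.4 / 5.5 / 3.4 at `n = 8 / 10 / 12`.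
* `stub_flagsFar` (XL, OPEN — interface to the block programme, = `lagrangian-splitting` (E) on the far stratum;
  `coset-web-block-peeling` structure conjecture): in-promise pairs NOT within the decoding radius of any exact
  cubic pair (P₄-type, 2ⁿ/4-far; products) have flags of bounded defect (P₄: defect 0, triage r1-2 App. B).
* `stub_flagDecider` (XL, algorithmic transfer): flags of bounded defect on the whole promise ⇒ `S`
  (FIND a flag — the ¬r3-strength search, finders = `polar-radical-seeds` / `dual-pair-meataxe-anchor` on intact
  slices, this locator as damage pre-processing; ESTIMATE by Lagrangian splitting; FP/Chebyshev plumbing as in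
  `CubicForrelationEstimatorMachine/Analysis.lean`).
* `flags_everywhere` (sorry-free): coreFlag + flagCut on the near stratum (the core is the one RadiusNear
  provides), flagsFar on the far stratum ⇒ flags of defect ≤ `max (t₂ + 2c) t₁` on the whole promise;
  `SignedCubicForrelationInPrBPP_of` = the crux BY NAME from the four stubs.

Disproof used (`Cruxes/SignedCubicForrelationInPrBPP/Disproof.lean`, cdisprove v2): §2 — no `_false_without_`
theorem exists for this crux (every hypothesis drop is a stronger membership claim); honoured instead: §3a
`no_negAt_invariant_decider` / `Negative.SignedSlice.signed_slice_defeats_table_deciders` — every statistic of THIS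
file (densities' power spectra, cuts, flags) is `negAt`-invariant BY DESIGN and none is used to decide; the sign
enters only in `stub_flagDecider`'s ESTIMATE step, whose samples carry `(-1)^{b(y)}` linearly (flip under `b ↦ ¬b`);
§3b `not_biquadraticPermsHaveAffineComponent` / `Negative.GoldCube` — constrains the FIND step (no triangular
peel), cited in `stub_flagDecider`; §3c `forrelation_mul_cross_eq` (`Negative.CrossCorrelation`) — `power_oneSided`
is its square (`power a b₀ w = Φ(a ⊕ ℓ_w, b₀)² = (2^{-n}⟨(-1)^{a₀}, (-1)^{a ⊕ ℓ_w}⟩)²`). Landed Negative lemmas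
`GoldCube`, `CrossCorrelation`, `SignedSlice`, `FlatSign` are imported above: no stub is an instance they refute
(they concern table-only deciders and peel totality; the stubs are flag statements and one flag ⇒ membership
transfer). Negatives index (`ledger negatives`): CubicStability (stmt-2202, P₄) — not used and not restated: nothing
here localises the promise near exact pairs; P₄ lives in `stub_flagsFar`'s stratum with a defect-0 flag.
-/

set_option linter.dupNamespace false
set_option linter.unusedVariables false

noncomputable section

open scoped Classical

namespace Summit.QuantumAdvantage.QuantumAdvantage.Cruxes.SignedCubicForrelationInPrBPP.TransposeDefectLocator

open Finset
open Literature.Computability.Complexity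
open Literature.Computability.QuantumComplexity
open Literature.Computability.QuantumComplexity.BuzetChailloux (bxor zeroVec twist_bxor_right
  twist_zeroVec_right signOf_sq phi_signOf bxor_comm bxor_bxor_cancel_left)
open Literature.Computability.QuantumComplexity.DerivativeWalsh
open Summit.QuantumAdvantage.QuantumAdvantage.Theses.CubicForrelation (SignedCubicForrelationInPrBPP)

variable {n : ℕ}

/-! ### §0 The crux by name -/

/-- The crux decl is, by `rfl`, membership of the tree's `signedCubicForrelationProblem 2`. -/
theorem crux_eq : SignedCubicForrelationInPrBPP = (signedCubicForrelationProblem 2 ∈ PromiseBPP') := rfl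

/-! ### §1 Vocabulary: third derivatives, subspaces, flags, juntas, the near stratum -/

/-- Third derivative `D_u D_v D_w a (x)` (XOR of `a` over the 8 vertices of the parallelepiped). -/
def D3 (a : (Fin n → Bool) → Bool) (u v w x : Fin n → Bool) : Bool :=
  a x ^^ a (bxor x u) ^^ a (bxor x v) ^^ a (bxor x w) ^^
    a (bxor (bxor x u) v) ^^ a (bxor (bxor x u) w) ^^ a (bxor (bxor x v) w) ^^
      a (bxor (bxor (bxor x u) v) w)

/-- A linear subspace of `𝔽₂ⁿ`, as a finset of bit vectors containing `0` and closed under `⊕`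
(the tree's convention, `ForrelationMSubspaceDuality.lean`). -/
def IsSubspace (V : Finset (Fin n → Bool)) : Prop :=
  zeroVec ∈ V ∧ ∀ x ∈ V, ∀ y ∈ V, bxor x y ∈ V

/-- `V` is ISOTROPIC for (the cubic tensor of) `a`: all third derivatives along `V` vanish, i.e. `a` has degree
≤ 2 on every coset of `V` (for `|V|² = 2ⁿ` and degree ≤ 1 this is an M-subspace, Carlet Prop. 54). -/
def IsIsotropic (a : (Fin n → Bool) → Bool) (V : Finset (Fin n → Bool)) : Prop :=
  ∀ u ∈ V, ∀ v ∈ V, ∀ w ∈ V, ∀ x, D3 a u v w x = false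

/-- `W ⊆ E^⊥`, read through the tree's `twist` (`(-1)^{e·w} = 1`). -/
def Orthogonal (E W : Finset (Fin n → Bool)) : Prop :=
  ∀ e ∈ E, ∀ w ∈ W, twist e w = 1

/-- **Bi-isotropic flag of defect ≤ `t`** for the pair `(a,b)`: subspaces `E`, `W ⊆ E^⊥`, `E` isotropic for `a`,
`W` isotropic for `b`, and `|E|·|W| ≥ 2^{n-t}` (so the Lagrangian-splitting estimator costs `2^t` Gauss sums per
sample). Defect 0 with `|E|² = 2ⁿ` is Dillon's M-subspace picture of an MM exact pair. -/
def HasFlag (t : ℕ) (a b : (Fin n → Bool) → Bool) : Prop :=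
  ∃ E W : Finset (Fin n → Bool), IsSubspace E ∧ IsSubspace W ∧ Orthogonal E W ∧
    IsIsotropic a E ∧ IsIsotropic b W ∧ 2 ^ n ≤ 2 ^ t * E.card * W.card

/-- Hamming distance of two Boolean functions. -/
def dist (a a₀ : (Fin n → Bool) → Bool) : ℕ :=
  (univ.filter fun x => a x ≠ a₀ x).card

/-- An EXACT CUBIC PAIR (core): both of degree ≤ 3 and `Φ = ±1` (`b₀` bent with dual `a₀` or `¬a₀`). -/
def IsExactCubicPair (a₀ b₀ : (Fin n → Bool) → Bool) : Prop :=
  IsDegLeFun 3 a₀ ∧ IsDegLeFun 3 b₀ ∧ forrelation a₀ b₀ ^ 2 = 1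

/-- The NEAR STRATUM: `(a,b)` lies within the unique-decoding radius `2^{n-2} = 2·d_min RM(3,n)` of an exact
cubic pair on BOTH sides (so both differences are Kasami–Tokura words). Its complement inside the promise is the
block/sporadic regime (P₄ is `2ⁿ/4`-far on one side). -/
def RadiusNear (a b : (Fin n → Bool) → Bool) : Prop :=
  ∃ a₀ b₀ : (Fin n → Bool) → Bool, IsExactCubicPair a₀ b₀ ∧ dist a a₀ < 2 ^ (n - 2) ∧ dist b b₀ < 2 ^ (n - 2)

/-! ### §2 The forrelation density and its power spectrum (the locator's statistics) -/

/-- **Forrelation density** `Ψ_{a,b}(x) = (-1)^{a(x)} · 2^{-n/2} · W_{(-1)^b}(x)`; `E_x Ψ = Φ(a,b)`, `E_x Ψ² = 1`,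
and `Ψ ≡ ±1` iff the pair is exact. -/
def density (a b : (Fin n → Bool) → Bool) (x : Fin n → Bool) : ℝ :=
  signOf (a x) * ((Real.sqrt ((2 : ℝ) ^ n))⁻¹ * W (fun y => signOf (b y)) x)

/-- **Power spectrum** of the density at `w`: `(2^{-n} Σ_x Ψ(x) (-1)^{w·x})²`. It equals `Φ(a ⊕ ℓ_w, b)²`
(`ℓ_w(x) = w·x`; twisting `a` by a linear form keeps it cubic), so every value is classically estimable by the
landed Φ²-estimator (`cubicKForrelationProblem_two_mem_PromiseBPP'` machinery); `Σ_w power = E Ψ² = 1`. -/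
def power (a b : (Fin n → Bool) → Bool) (w : Fin n → Bool) : ℝ :=
  (((2 : ℝ) ^ n)⁻¹ * ∑ x, density a b x * twist w x) ^ 2

/-- `h` is orthogonal to every `τ`-heavy direction of the power spectrum of `(a,b)` (at most `1/τ` of them). -/
def OrthHeavy (τ : ℝ) (a b : (Fin n → Bool) → Bool) (h : Fin n → Bool) : Prop :=
  ∀ w, τ ≤ power a b w → twist w h = 1

/-- **The locator's cut**: `E ∩ Heavy_τ(power a b)^⊥`. (For the `b`-side use `cut τ b a W`: the dual density.) -/
def cut (τ : ℝ) (a b : (Fin n → Bool) → Bool) (E : Finset (Fin n → Bool)) : Finset (Fin n → Bool) :=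
  E.filter fun h => OrthHeavy τ a b h

/-! ### §3 PROVED: the transposed-table statistics are the autocorrelation of the density -/

/-- Row `h` of `T_f` against column `h` of `T_g`, closed form (all real `f g`):
`Σ_u T_f(h,u) T_g(u,h) = Σ_x f(x) f(x⊕h) · W_g(x) W_g(x⊕h)` (from the tree's `sum_dwt_mul_dwt_row`). -/
theorem sum_dwt_mul_dwt_row_eq_W (f g : (Fin n → Bool) → ℝ) (h : Fin n → Bool) :
    ∑ u, dwt f h u * dwt g u h = ∑ x, f x * f (bxor x h) * (W g x * W g (bxor x h)) := by
  rw [sum_dwt_mul_dwt_row]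
  refine sum_congr rfl fun x _ => ?_
  have key : ∑ y, g y * twist y x * twist h y = W g (bxor x h) := by
    unfold W
    refine sum_congr rfl fun y _ => ?_
    rw [twist_bxor_right, twist_comm h y]
    ring
  rw [key]

/-- **ROW-SCORE IDENTITY** (the lever of the card, exact): for Boolean `a b` and every direction `h`,
`Σ_u T_a(h,u) · T_b(u,h) = 2ⁿ · Σ_x Ψ_{a,b}(x) Ψ_{a,b}(x ⊕ h)`. Summing over `h` recovers the landed
`2^{3n} Φ² = Σ_{h,u} T_a T_b` (`two_pow_mul_forrelation_sq`); row by row it says the card's agreement/score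
statistics are the AUTOCORRELATION of the forrelation density, whose Fourier transform is `power a b`. -/
theorem rowScore_eq (a b : (Fin n → Bool) → Bool) (h : Fin n → Bool) :
    ∑ u, dwt (fun x => signOf (a x)) h u * dwt (fun y => signOf (b y)) u h =
      (2 : ℝ) ^ n * ∑ x, density a b x * density a b (bxor x h) := by
  rw [sum_dwt_mul_dwt_row_eq_W, mul_sum]
  refine sum_congr rfl fun x _ => ?_
  unfold density
  have hs : (Real.sqrt ((2 : ℝ) ^ n))⁻¹ * (Real.sqrt ((2 : ℝ) ^ n))⁻¹ = ((2 : ℝ) ^ n)⁻¹ := by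
    rw [← mul_inv, Real.mul_self_sqrt (by positivity)]
  have h2 : (2 : ℝ) ^ n ≠ 0 := by positivity
  calc signOf (a x) * signOf (a (bxor x h)) *
        (W (fun y => signOf (b y)) x * W (fun y => signOf (b y)) (bxor x h))
      = ((2 : ℝ) ^ n * ((Real.sqrt ((2 : ℝ) ^ n))⁻¹ * (Real.sqrt ((2 : ℝ) ^ n))⁻¹)) *
          (signOf (a x) * signOf (a (bxor x h)) *
            (W (fun y => signOf (b y)) x * W (fun y => signOf (b y)) (bxor x h))) := by
        rw [hs, mul_inv_cancel₀ h2, one_mul]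
    _ = _ := by ring

/-- `Φ(a,b) = E_x Ψ_{a,b}(x)`: the forrelation is the mean of the density. -/
theorem forrelation_eq_mean_density (a b : (Fin n → Bool) → Bool) :
    forrelation a b = ((2 : ℝ) ^ n)⁻¹ * ∑ x, density a b x := by
  have h1 := fsum_signOf_eq a b
  rw [fsum_eq_sum_mul_W, sqrt_two_pow_three_mul] at h1
  unfold density
  have hs : Real.sqrt ((2 : ℝ) ^ n) ≠ 0 := by positivity
  have h2 : (2 : ℝ) ^ n ≠ 0 := by positivity
  have e : ∑ x, signOf (a x) * ((Real.sqrt ((2 : ℝ) ^ n))⁻¹ * W (fun y => signOf (b y)) x) =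
      (Real.sqrt ((2 : ℝ) ^ n))⁻¹ * ∑ x, signOf (a x) * W (fun y => signOf (b y)) x := by
    rw [mul_sum]
    exact sum_congr rfl fun x _ => by ring
  rw [e, h1]
  field_simp

/-- `power a b 0 = Φ(a,b)²`: the landed Φ²-estimate is the power spectrum at the origin. -/
theorem power_zeroVec (a b : (Fin n → Bool) → Bool) : power a b zeroVec = forrelation a b ^ 2 := by
  unfold power
  simp_rw [twist_comm zeroVec, twist_zeroVec_right, mul_one]
  rw [← forrelation_eq_mean_density]

/-! ### §4 PROVED: the one-sided location theorem in spectral form -/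

/-- **One-sided damage, pointwise**: if `Φ(a₀,b₀)² = 1` then for ANY `δ` the density of the damaged pair
`(a₀ ⊕ δ, b₀)` is `Φ(a₀,b₀) · (-1)^{δ}` — the damage itself, up to the core's sign
(rigidity `2ⁿ W_{b₀} = S · (-1)^{a₀}`, `ForrelationSignTransport.two_pow_mul_W_eq`). -/
theorem density_oneSided (a₀ b₀ δ : (Fin n → Bool) → Bool) (hΦ : forrelation a₀ b₀ ^ 2 = 1)
    (x : Fin n → Bool) :
    density (fun x => a₀ x ^^ δ x) b₀ x = forrelation a₀ b₀ * signOf (δ x) := by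
  have hf : ∀ x, (fun x => signOf (a₀ x)) x ^ 2 = 1 := fun x => signOf_sq _
  have hg : ∀ y, (fun y => signOf (b₀ y)) y ^ 2 = 1 := fun y => signOf_sq _
  have hS := fsum_signOf_sq_of_forrelation_sq a₀ b₀ hΦ
  have hW := two_pow_mul_W_eq _ _ hf hg hS x
  rw [fsum_signOf_eq, sqrt_two_pow_three_mul] at hW
  have h2 : (0 : ℝ) < (2 : ℝ) ^ n := by positivity
  have hW' : W (fun y => signOf (b₀ y)) x =
      Real.sqrt ((2 : ℝ) ^ n) * forrelation a₀ b₀ * signOf (a₀ x) := by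
    apply mul_left_cancel₀ h2.ne'
    rw [hW]
    ring
  unfold density
  rw [hW', signOf_xor]
  have hs : Real.sqrt ((2 : ℝ) ^ n) ≠ 0 := by positivity
  have hinv : (Real.sqrt ((2 : ℝ) ^ n))⁻¹ * Real.sqrt ((2 : ℝ) ^ n) = 1 := inv_mul_cancel₀ hs
  have ha : signOf (a₀ x) * signOf (a₀ x) = 1 := by rw [← sq]; exact signOf_sq _
  linear_combination (signOf (δ x) * forrelation a₀ b₀ * ((Real.sqrt ((2 : ℝ) ^ n))⁻¹ *
    Real.sqrt ((2 : ℝ) ^ n))) * ha + (signOf (δ x) * forrelation a₀ b₀) * hinv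

/-- **ONE-SIDED LOCATION THEOREM (spectral form)**: for an exact core and one-sided damage `a = a₀ ⊕ δ`,
`power a b₀ w = (2^{-n} W_{(-1)^δ}(w))²` — the power spectrum of the damaged pair IS the Walsh power spectrum of
the damage. Consequently the `τ`-heavy directions are the Walsh support of `δ` (for a `K`-junta of forms every
non-zero normalised coefficient is a multiple of `2^{-K}`, so `τ = 4^{-K}` sees all of it), which spans `dir(δ)^⊥`;
`cut τ a b₀ E = E ∩ dir(δ)` for every `E` — the one-sided case of `stub_flagCut`. -/
theorem power_oneSided (a₀ b₀ δ : (Fin n → Bool) → Bool) (hΦ : forrelation a₀ b₀ ^ 2 = 1)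
    (w : Fin n → Bool) :
    power (fun x => a₀ x ^^ δ x) b₀ w = (((2 : ℝ) ^ n)⁻¹ * ∑ x, signOf (δ x) * twist w x) ^ 2 := by
  unfold power
  simp_rw [density_oneSided a₀ b₀ δ hΦ]
  have e : ∑ x, forrelation a₀ b₀ * signOf (δ x) * twist w x =
      forrelation a₀ b₀ * ∑ x, signOf (δ x) * twist w x := by
    rw [mul_sum]
    exact sum_congr rfl fun x _ => by ring
  rw [e, mul_left_comm, mul_pow, hΦ, one_mul]

/-! ### §4b PROVED: Parseval for the power spectrum (`Σ_w power = 1`, so `#Heavy_τ ≤ 1/τ`) -/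

/-- `Σ_x Ψ_{a,b}(x)² = 2ⁿ` (`E Ψ² = 1`; Parseval for `W_b`). -/
theorem sum_density_sq (a b : (Fin n → Bool) → Bool) : ∑ x, density a b x ^ 2 = (2 : ℝ) ^ n := by
  unfold density
  have hW : ∑ x, W (fun y => signOf (b y)) x ^ 2 = (2 : ℝ) ^ n * (2 : ℝ) ^ n := by
    rw [sum_W_sq]
    simp_rw [signOf_sq, sum_const, card_univ, Fintype.card_fun, Fintype.card_bool, Fintype.card_fin,
      nsmul_eq_mul, mul_one]
    push_cast; ring
  have hs2 : (Real.sqrt ((2 : ℝ) ^ n))⁻¹ ^ 2 = ((2 : ℝ) ^ n)⁻¹ := by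
    rw [inv_pow, Real.sq_sqrt (by positivity)]
  have e : ∀ x, (signOf (a x) * ((Real.sqrt ((2 : ℝ) ^ n))⁻¹ * W (fun y => signOf (b y)) x)) ^ 2 =
      ((2 : ℝ) ^ n)⁻¹ * W (fun y => signOf (b y)) x ^ 2 := by
    intro x
    rw [mul_pow, mul_pow, signOf_sq, one_mul, hs2]
  simp_rw [e]
  rw [← mul_sum, hW]
  have h2 : (2 : ℝ) ^ n ≠ 0 := by positivity
  field_simp

/-- **Parseval for the power spectrum**: `Σ_w power a b w = 1`. -/
theorem sum_power_eq_one (a b : (Fin n → Bool) → Bool) : ∑ w, power a b w = 1 := by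
  unfold power
  have key : ∑ w, (∑ x, density a b x * twist w x) ^ 2 = (2 : ℝ) ^ n * ∑ x, density a b x ^ 2 := by
    have e : ∀ w, (∑ x, density a b x * twist w x) = W (density a b) w := by
      intro w; unfold W; exact sum_congr rfl fun x _ => by rw [twist_comm w x]
    simp_rw [e]; exact sum_W_sq (density a b)
  simp_rw [mul_pow]
  rw [← mul_sum, key, sum_density_sq]
  have h2 : (2 : ℝ) ^ n ≠ 0 := by positivity
  field_simp

/-- **At most `1/τ` directions are `τ`-heavy**: `#Heavy_τ · τ ≤ 1` — the dimension budget of the cut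
(`c ≤ 1/τ` per side in `stub_flagCut`, one-sided case). -/
theorem card_heavy_mul_le (a b : (Fin n → Bool) → Bool) (τ : ℝ) :
    ((univ.filter fun w => τ ≤ power a b w).card : ℝ) * τ ≤ 1 := by
  have hnn : ∀ w, 0 ≤ power a b w := fun w => sq_nonneg _
  calc ((univ.filter fun w => τ ≤ power a b w).card : ℝ) * τ
      = ∑ w ∈ univ.filter (fun w => τ ≤ power a b w), τ := by rw [sum_const, nsmul_eq_mul]
    _ ≤ ∑ w ∈ univ.filter (fun w => τ ≤ power a b w), power a b w :=
        sum_le_sum fun w hw => (mem_filter.1 hw).2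
    _ ≤ ∑ w, power a b w :=
        sum_le_sum_of_subset_of_nonneg (filter_subset _ _) fun w _ _ => hnn w
    _ = 1 := sum_power_eq_one a b

/-! ### §5 Small certified glue for the composition (no sorry) -/

theorem cut_subset (τ : ℝ) (a b : (Fin n → Bool) → Bool) (E : Finset (Fin n → Bool)) :
    cut τ a b E ⊆ E :=
  filter_subset _ _

theorem isSubspace_cut (τ : ℝ) (a b : (Fin n → Bool) → Bool) {E : Finset (Fin n → Bool)}
    (hE : IsSubspace E) : IsSubspace (cut τ a b E) := by
  refine ⟨mem_filter.2 ⟨hE.1, fun w _ => twist_zeroVec_right w⟩, fun x hx y hy => ?_⟩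
  obtain ⟨hxE, hx⟩ := mem_filter.1 hx
  obtain ⟨hyE, hy⟩ := mem_filter.1 hy
  refine mem_filter.2 ⟨hE.2 x hxE y hyE, fun w hw => ?_⟩
  rw [twist_bxor_right, hx w hw, hy w hw, one_mul]

theorem orthogonal_cut {τ τ' : ℝ} {a b a' b' : (Fin n → Bool) → Bool} {E W : Finset (Fin n → Bool)}
    (h : Orthogonal E W) : Orthogonal (cut τ a b E) (cut τ' a' b' W) :=
  fun e he w hw => h e (cut_subset _ _ _ _ he) w (cut_subset _ _ _ _ hw)

theorem hasFlag_mono {t t' : ℕ} (h : t ≤ t') {a b : (Fin n → Bool) → Bool} (hf : HasFlag t a b) :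
    HasFlag t' a b := by
  obtain ⟨E, W, hE, hW, hO, ha, hb, hc⟩ := hf
  refine ⟨E, W, hE, hW, hO, ha, hb, hc.trans ?_⟩
  have h2 : 2 ^ t ≤ 2 ^ t' := Nat.pow_le_pow_right (by norm_num) h
  exact Nat.mul_le_mul_right _ (Nat.mul_le_mul_right _ h2)

/-! ### §6 Registered stubs -/

/-- **STUB 1 — `stub_coreFlag` (L; known shape, shared with the r5 lines and `lagrangian-splitting` (E)).**
Every exact cubic pair (`n` even) has a bi-isotropic flag of defect ≤ `t₂`, `t₂` absolute. For completed
Maiorana–McFarland `b₀ = y′·π(y″) ⊕ h(y″)` take `W =` the M-subspace (`y″ = 0` directions, `b₀` affine on its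
cosets) and `E = W^⊥` (`a₀` affine on its cosets by the LANDED `DerivativeWalsh.dual_affine_on_perp_cosets`):
defect 0. So route item r5 `ExactPairsMaioranaMcFarland` (exact cubic pairs are MM#) + Carlet 2020 Prop. 54
(MM# ⇔ `n/2`-dimensional M-subspace) give it with `t₂ = 0`; it is TRUE outright for `n ≤ 8` (all cubic bent
functions are MM#). Stated weaker than r5 on purpose (a non-MM# cubic exact pair with a near-half-dimensional
isotropic pair would still do). WHY IT MIGHT FAIL: a cubic bent function outside MM# WITH CUBIC DUAL and only
`O(√n)`-dimensional isotropic subspaces (none known; PP20's non-MM# cubic bents have quartic duals). -/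
theorem stub_coreFlag : ∃ t₂ : ℕ, ∀ (n : ℕ), Even n → ∀ a₀ b₀ : (Fin n → Bool) → Bool,
    IsDegLeFun 3 a₀ → IsDegLeFun 3 b₀ → forrelation a₀ b₀ ^ 2 = 1 → HasFlag t₂ a₀ b₀ := by
  sorry

/-- **STUB 2 — `stub_flagCut` (L, OPEN — THIS LINE'S LOAD-BEARING STATEMENT; the transpose-defect locator as a
flag-shrinker).** For every core-flag defect `t₂` there are `τ > 0` and `c` such that: if `(a,b)` is an in-promise
cubic pair (`n` even, `|Φ| ≥ 3/5`) within the unique-decoding radius `2^{n-2}` of an exact cubic core `(a₁,b₁)` on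
both sides (so both differences are Kasami–Tokura words), and `(E, W)` is a bi-isotropic pair of the CORE of defect
≤ `t₂`, then cutting by the heavy directions of the two power spectra, `E′ = E ∩ Heavy_τ(power a b)^⊥`,
`W′ = W ∩ Heavy_τ(power b a)^⊥`, gives a bi-isotropic pair of `(a,b)` and costs at most `c` dimensions per side
(`W′ ⊆ W ⊆ E^⊥ ⊆ E′^⊥` and subspace-ness are automatic, §5; the new defect is ≤ `t₂ + 2c`). ONE-SIDED case
(`b = b₁`): TRUE — `|Φ| = 1 - 2·wt(δ)/2ⁿ ≥ 3/5` confines `δ = a ⊕ a₁` to the KT types `x₁x₂x₃`, `x₁(x₂x₃ ⊕ x₄x₅)`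
(≤ 5 forms), `power_oneSided` makes `Heavy_{4^{-5}}` the Walsh support of `δ`, which spans `dir(δ)^⊥`, so
`E′ = E ∩ dir(δ)` is isotropic for `a = a₁ ⊕ δ` (`T_δ(h,·,·) = 0` for `h ∈ dir δ`) with `|E|/|E′| ≤ 2^5`, while `W′ ⊆ W`
stays isotropic for `b₁`; in general `#Heavy_τ ≤ 1/τ` (Parseval `Σ_w power = 1`) bounds `c ≤ 1/τ`. TWO-SIDED:
`Ψ = ε(-1)^δ(1 - 2φ)` with `φ` the `b`-damage transported through the core duality; in-promise two-sided damage
needs a large cross term (Lindsey), i.e. alignment with the core, and the bet is that every direction along which it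
breaks isotropy of the core flag stays `τ`-heavy despite interference. Hand checks: T-family (`n = 10`, `Φ = 7/8`,
inner-product core): `Ψ = ±(-1)^{1_F}`, `F` the codim-4 flat `x″₅x′₁x′₂x′₃`, `Heavy_{1/64}(power a b) = U_F^⊥` cuts `⟨e″ᵢ⟩ ↦ ⟨e″₁…e″₄⟩`, and the spikes
of the affine derivatives `D_v b_T` (`v ∈ U_F^⊥`, e.g. `D_{e′₁⊕e′₂} b_T = y″₁ ⊕ y″₂ ⊕ y′₄`) in `power b a` cut
`⟨e′ᵢ⟩ ↦ ⟨e′₁, e′₂, e′₃⟩`; both isotropic: PASSES with `c = 2`; iterated shears (module docstring):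
no cut needed, PASS. The defect parameter `t₂` excludes nothing in the MM picture (`t₂ = 0`) but keeps out lopsided
tiny core pairs on which `T_{a₁}` vanishes only by cancellation against `T_{a⊕a₁}`. WHY IT MIGHT FAIL: destructive
interference (a structured core whose partial autocorrelations over the damage support cancel a spike of `(-1)^δ`
exactly) hiding a needed cut; or an alternative radius-near core whose large flags are isotropic for `a₁` but not for
the true dual. Cheapest falsifier RUN: kit j013398 — 768/768 in-promise instances at `n ≤ 12` pass at `τ = 1/64`
(module docstring); what would kill the stub is ONE in-promise radius-near instance, core and defect-≤-`t₂` core flag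
with `isoE′ = N` or `isoW′ = N` at every `τ` — next places to look: Gold⊕Gold⊕Gold cores with damage straddling blocks,
`n = 18`, and non-canonical (lopsided) core flags. -/
theorem stub_flagCut : ∀ t₂ : ℕ, ∃ τ : ℝ, 0 < τ ∧ ∃ c : ℕ, ∀ (n : ℕ), Even n →
    ∀ a b a₁ b₁ : (Fin n → Bool) → Bool,
    IsDegLeFun 3 a → IsDegLeFun 3 b → (3 / 5 : ℝ) ≤ |forrelation a b| →
    IsExactCubicPair a₁ b₁ → dist a a₁ < 2 ^ (n - 2) → dist b b₁ < 2 ^ (n - 2) →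
    ∀ E W : Finset (Fin n → Bool), IsSubspace E → IsSubspace W → Orthogonal E W →
    IsIsotropic a₁ E → IsIsotropic b₁ W → 2 ^ n ≤ 2 ^ t₂ * E.card * W.card →
      IsIsotropic a (cut τ a b E) ∧ IsIsotropic b (cut τ b a W) ∧
        E.card ≤ 2 ^ c * (cut τ a b E).card ∧ W.card ≤ 2 ^ c * (cut τ b a W).card := by
  sorry

/-- **STUB 3 — `stub_flagsFar` (XL, OPEN — interface to the block programme; = `lagrangian-splitting`'s flag
existence (E) restricted to the FAR stratum, = the `coset-web-block-peeling` structure conjecture read through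
flags).** Every in-promise cubic pair (`n` even, `|Φ| ≥ 3/5`) that is NOT within the decoding radius of an exact
cubic pair has a bi-isotropic flag of defect ≤ `t₁`, `t₁` absolute. Evidence: the CubicStability witness P₄
(`n = 12`, `Φ = 625/1024`, `2ⁿ/4`-far) has a defect-0 flag (triage r1-2 Appendix B); products of exact/near-exact
blocks multiply `Φ` (`forrelation_directSum`) and add flags; RM(2) couplings are invisible to third derivatives.
This is not this line's content — it is where the lead plugs the block programme's skeleton; `S` implies nothing
weaker would do on this stratum short of another estimator. WHY IT MIGHT FAIL: an in-promise far pair whose two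
cubic tensors admit only `o(n)`-codimension… i.e. only `n/2 - ω(1)`-dimensional isotropic subspaces (candidates:
cubic truncations around PolujanPott2020 non-MM# bents; none known in the promise). -/
theorem stub_flagsFar : ∃ t₁ : ℕ, ∀ (n : ℕ), Even n → ∀ a b : (Fin n → Bool) → Bool,
    IsDegLeFun 3 a → IsDegLeFun 3 b → (3 / 5 : ℝ) ≤ |forrelation a b| → ¬ RadiusNear a b →
      HasFlag t₁ a b := by
  sorry

/-- **STUB 4 — `stub_flagDecider` (XL; the algorithmic transfer "flags everywhere ⇒ S").** If every in-promise
cubic pair on an even number of bits has a bi-isotropic flag of defect ≤ `t` (one absolute `t`), then signed cubic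
2-fold Forrelation is in `PromiseBPP'`. Proof shape (three layers, none formalised yet):
FIND — a randomised `poly(n)·2^{O(t)}` search outputting SOME flag of defect `O(t)` w.h.p. (validity of a
candidate flag is an exact linear-algebra check on the ANF); sub-routines: first-polar seeds + ping-pong closure
(`polar-radical-seeds`, `seed-to-sign`), module decomposition of `⟨T_a ∘ T_b⟩` (`dual-pair-meataxe-anchor`; the
finder MUST NOT assume affine components of `π`: Disproof §3b, `Negative.GoldCube`), centroid block splitting
(`coset-web-block-peeling`), and THIS locator as damage pre-processing: estimate row scores
`s(h) = 4^{-n} Σ_u T_a(h,u)T_b(u,h)` (landed sampler; `rowScore_eq`), run Kushilevitz–Mansour on `s` (its Fourier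
coefficients are the values `power a b w ≥ 0`, `≤ 1/τ` of them `τ`-heavy), cut, and run the finders on the cut /
intact slices. This layer carries the ¬r3-strength claim "BI-ISO is easy" (route item
`SignedExactCubicForrelationNotPrBPP` is refuted by it on the exact slice: `Disproof.crux_imp_not_signedExact`).
ESTIMATE — Lagrangian splitting (`lagrangian-splitting`): with `x = u ⊕ e`, `y = v ⊕ w` along the flag,
`Φ = 2^{-2n+…} Σ_{u,v} (-1)^{u·v} S_a(u,v) S_b(v,u)`, `E X = Φ` exactly, `E X² ≤ 1`, each sample `2^t` quadratic
Gauss sums (Dickson; `BravyiGosset.GData.gaussEval`, `gaussEval_codeFP`) — the ONLY sign-sensitive step (its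
samples flip under `b ↦ ¬b`, as Disproof §3a demands). PLUMB — `FP` witness + Chebyshev over coin blocks +
succinct-input guard exactly as `CubicForrelationEstimatorMachine/Analysis.lean`
(`PromiseProblem.mem_PromiseBPP'_of_fp_decider`). -/
theorem stub_flagDecider
    (hflags : ∃ t : ℕ, ∀ (n : ℕ), Even n → ∀ a b : (Fin n → Bool) → Bool,
      IsDegLeFun 3 a → IsDegLeFun 3 b → (3 / 5 : ℝ) ≤ |forrelation a b| → HasFlag t a b) :
    signedCubicForrelationProblem 2 ∈ PromiseBPP' := by
  sorry

/-! ### §7 The composition (kernel-checked, sorry-free) -/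

/-- **Flags everywhere** from the stub STATEMENTS as hypotheses (sorry-free): on the near stratum the core that
`RadiusNear` provides has a flag of defect ≤ `t₂` (coreFlag), whose heavy-direction cut is a flag of `(a,b)`
(flagCut) of defect ≤ `t₂ + 2c`; on the far stratum flagsFar; hence defect ≤ `max (t₂ + 2c) t₁` everywhere. -/
theorem flags_everywhere
    (hcore : ∃ t₂ : ℕ, ∀ (n : ℕ), Even n → ∀ a₀ b₀ : (Fin n → Bool) → Bool,
      IsDegLeFun 3 a₀ → IsDegLeFun 3 b₀ → forrelation a₀ b₀ ^ 2 = 1 → HasFlag t₂ a₀ b₀)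
    (hcut : ∀ t₂ : ℕ, ∃ τ : ℝ, 0 < τ ∧ ∃ c : ℕ, ∀ (n : ℕ), Even n →
      ∀ a b a₁ b₁ : (Fin n → Bool) → Bool,
      IsDegLeFun 3 a → IsDegLeFun 3 b → (3 / 5 : ℝ) ≤ |forrelation a b| →
      IsExactCubicPair a₁ b₁ → dist a a₁ < 2 ^ (n - 2) → dist b b₁ < 2 ^ (n - 2) →
      ∀ E W : Finset (Fin n → Bool), IsSubspace E → IsSubspace W → Orthogonal E W →
      IsIsotropic a₁ E → IsIsotropic b₁ W → 2 ^ n ≤ 2 ^ t₂ * E.card * W.card →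
        IsIsotropic a (cut τ a b E) ∧ IsIsotropic b (cut τ b a W) ∧
          E.card ≤ 2 ^ c * (cut τ a b E).card ∧ W.card ≤ 2 ^ c * (cut τ b a W).card)
    (hfar : ∃ t₁ : ℕ, ∀ (n : ℕ), Even n → ∀ a b : (Fin n → Bool) → Bool,
      IsDegLeFun 3 a → IsDegLeFun 3 b → (3 / 5 : ℝ) ≤ |forrelation a b| → ¬ RadiusNear a b →
        HasFlag t₁ a b) :
    ∃ t : ℕ, ∀ (n : ℕ), Even n → ∀ a b : (Fin n → Bool) → Bool,
      IsDegLeFun 3 a → IsDegLeFun 3 b → (3 / 5 : ℝ) ≤ |forrelation a b| → HasFlag t a b := by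
  obtain ⟨t₂, hcore⟩ := hcore
  obtain ⟨τ, hτ, c, hcut⟩ := hcut t₂
  obtain ⟨t₁, hfar⟩ := hfar
  refine ⟨max (t₂ + (c + c)) t₁, fun n hn a b ha hb hΦ => ?_⟩
  by_cases hnear : RadiusNear a b
  · obtain ⟨a₁, b₁, hex, hda, hdb⟩ := hnear
    obtain ⟨E, W, hE, hW, hO, hEa, hWb, hcard⟩ := hcore n hn a₁ b₁ hex.1 hex.2.1 hex.2.2
    obtain ⟨hA, hB, hcE, hcW⟩ :=
      hcut n hn a b a₁ b₁ ha hb hΦ hex hda hdb E W hE hW hO hEa hWb hcard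
    refine hasFlag_mono (le_max_left _ _) ⟨cut τ a b E, cut τ b a W, isSubspace_cut τ a b hE,
      isSubspace_cut τ b a hW, orthogonal_cut hO, hA, hB, ?_⟩
    calc 2 ^ n ≤ 2 ^ t₂ * E.card * W.card := hcard
      _ ≤ 2 ^ t₂ * (2 ^ c * (cut τ a b E).card) * (2 ^ c * (cut τ b a W).card) := by gcongr
      _ = 2 ^ (t₂ + (c + c)) * (cut τ a b E).card * (cut τ b a W).card := by
        rw [pow_add, pow_add]; ring
  · exact hasFlag_mono (le_max_right _ _) (hfar n hn a b ha hb hΦ hnear)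

/-- **THE COMPOSITION.** The crux `CubicForrelation.SignedCubicForrelationInPrBPP` BY NAME from the four
registered stubs (`sorry` lives only inside `stub_*`): flags everywhere (coreFlag, flagCut, flagsFar) fed to the
flag decider. -/
theorem SignedCubicForrelationInPrBPP_of : SignedCubicForrelationInPrBPP :=
  crux_eq.mpr (stub_flagDecider (flags_everywhere stub_coreFlag stub_flagCut stub_flagsFar))

end Summit.QuantumAdvantage.QuantumAdvantage.Cruxes.SignedCubicForrelationInPrBPP.TransposeDefectLocator

end
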